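import Mathlib
import HarnessLib
import Literature.Dynamics.TransferOperators.MayerTransferOperatorExistence
import Literature.Dynamics.TransferOperators.HurwitzTrapezoid

/-!
# RiemannHypothesis / MayerPairing — Mayer's continued sum on the half-plane `Re z > -1/2`

Route `RiemannHypothesis/MayerPairing`, helper file for item stmt-RiemannHypothesis-1473 (`Target`):
the analytic lemmas behind the predicate audit `MayerPairingEigenvaluePredicate.lean` (the route's
inlined three-term eigenvalue predicate = nonzero point spectrum of Mayer's `L_s` on `B(D)`).
The Literature library `Literature.Dynamics.TransferOperators` constructs Mayer's `L_s` on `B(D)`,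
`D = {|z - 1| < 3/2}`, through the `κ = 0` continued pointwise formula
`mayerSum₀ s F z = F 0 · ζ(2s, z+1) + ∑ₙ (z+n+1)^{-2s} (F(1/(z+n+1)) - F 0)` and proves its estimates
on the closed disc; the audit needs them on the half-plane `Re z > -1/2` (where all branch points
`1/(z+n+1)` still lie in `{|w - 1| ≤ 1} ⊂ D`):
* `mayerPairing_norm_mayerTerm_sub_le`, `mayerPairing_summable_mayerTerm_sub`,
  `mayerPairing_differentiableOn_mayerSum₀` — term estimate, convergence, holomorphy of
  `z ↦ (L_s f)(z)` on `Re z > -1/2` for `f ∈ B(D)` (`0 < Re s`, `s ≠ 1/2`);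
* `mayerPairing_mayerSum₀_sub_mayerSum₀_add_one` — `(L_s f)(z) - (L_s f)(z+1) = (z+1)^{-2s} f(1/(z+1))`;
* `mayerPairing_tendsto_mayerSum₀_normalisation` — `(L_s f)(x) - f(0)(x+1)^{1-2s}/(2s-1) → 0` along
  the reals (decay in `x`: `mayerPairing_norm_mayerTerm_sub_le_real`);
* `mayerPairing_eqOn_zero_of_real_zeros` (identity theorem along a real interval),
  `mayerPairing_eq_zero_of_periodic_of_tendsto` (a `1`-periodic holomorphic function on the
  half-plane tending to `0` along the reals vanishes), and small geometric lemmas.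

References: D. Mayer, Comm. Math. Phys. 130 (1990) 311–333, Thm. 5; C.-H. Chang, D. Mayer,
Contemp. Math. 290 (2001) 1–40, (2.46)–(2.48), (3.21)–(3.23).
-/

namespace Summit.RiemannHypothesis.RiemannHypothesis.Theorems

open Filter Topology Metric Set Complex
open scoped Real
open Literature.Dynamics.TransferOperators

/-! ### Part 1. Mayer's continued sum on the half-plane `Re z > -1/2` -/

/-- On the closed half-plane `Re z ≥ -1/2`: `Re (z + n + 1) ≥ n + 1/2`. [folklore] -/
theorem mayerPairing_re_add_natCast_succ_ge {z : ℂ} (hz : -(1 / 2 : ℝ) ≤ z.re) (n : ℕ) :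
    (n : ℝ) + 1 / 2 ≤ (z + (n + 1)).re := by
  simp only [add_re, natCast_re, one_re]
  linarith

/-- On the closed half-plane `Re z ≥ -1/2` the inverse branch points `1/(z+n+1)` lie in the disc
`|w - 1| ≤ 1 ⊂ D`. [folklore] -/
theorem mayerPairing_one_div_branch_mem {z : ℂ} (hz : -(1 / 2 : ℝ) ≤ z.re) (n : ℕ) :
    1 / (z + (n + 1)) ∈ closedBall (1 : ℂ) 1 :=
  one_div_mem_closedBall_one_one (by
    have := mayerPairing_re_add_natCast_succ_ge hz n
    have hn : (0 : ℝ) ≤ n := n.cast_nonneg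
    linarith)

/-- **Term estimate on the half-plane** `Re z ≥ -1/2` (same constant as on the closed disc):
`‖(z+n+1)^{-2s} (f(1/(z+n+1)) - f(0))‖ ≤ 2 e^{π|Im 2s|/2} ‖f‖ (n + 1/2)^{-(2 Re s + 1)}` for
`f ∈ B(D)`, `Re s ≥ 0`. [folklore] -/
theorem mayerPairing_norm_mayerTerm_sub_le (f : MayerSpace) {z : ℂ} (hz : -(1 / 2 : ℝ) ≤ z.re)
    {s : ℂ} (hs : 0 ≤ s.re) (n : ℕ) :
    ‖mayerTerm s (fun w => f.toFun w - f.toFun 0) n z‖ ≤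
      2 * Real.exp (π / 2 * |(2 * s).im|) * ‖f‖ * ((n : ℝ) + 1 / 2) ^ (-(2 * s.re + 1)) := by
  have hpos : (0 : ℝ) < (n : ℝ) + 1 / 2 := by positivity
  have hre' := mayerPairing_re_add_natCast_succ_ge hz n
  have hre : 0 < (z + (n + 1)).re := hpos.trans_le hre'
  -- the power factor
  have hw : (-(2 * s)).re ≤ 0 := by simp; linarith
  have h1 : ‖(z + (n + 1)) ^ (-(2 * s))‖ ≤
      Real.exp (π / 2 * |(2 * s).im|) * ((n : ℝ) + 1 / 2) ^ (-(2 * s.re)) := by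
    have h := norm_cpow_le_re_rpow_of_re_pos hre hw
    have hexp : (-(2 * s)).re = -(2 * s.re) := by simp
    have him : |(-(2 * s)).im| = |(2 * s).im| := by rw [neg_im, abs_neg]
    rw [hexp, him] at h
    refine h.trans ?_
    rw [mul_comm]
    refine mul_le_mul_of_nonneg_left ?_ (Real.exp_pos _).le
    exact Real.rpow_le_rpow_of_nonpos hpos hre' (by linarith)
  -- the Lipschitz factor
  have h2 : ‖f.toFun (1 / (z + (n + 1))) - f.toFun 0‖ ≤ 2 * ‖f‖ * ((n : ℝ) + 1 / 2)⁻¹ := by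
    refine (f.norm_toFun_sub_toFun_zero_le (mayerPairing_one_div_branch_mem hz n)).trans ?_
    refine mul_le_mul_of_nonneg_left ?_ (by positivity)
    have h3 : (n : ℝ) + 1 / 2 ≤ ‖z + (n + 1)‖ := hre'.trans (re_le_norm _)
    rw [norm_div, norm_one, one_div]
    exact inv_anti₀ hpos h3
  have hsplit : ((n : ℝ) + 1 / 2) ^ (-(2 * s.re + 1)) =
      ((n : ℝ) + 1 / 2) ^ (-(2 * s.re)) * ((n : ℝ) + 1 / 2)⁻¹ := by
    rw [show -(2 * s.re + 1) = -(2 * s.re) + (-1) by ring, Real.rpow_add hpos, Real.rpow_neg_one]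
  unfold mayerTerm
  rw [norm_mul, hsplit]
  calc ‖(z + (n + 1)) ^ (-(2 * s))‖ * ‖f.toFun (1 / (z + (n + 1))) - f.toFun 0‖
      ≤ (Real.exp (π / 2 * |(2 * s).im|) * ((n : ℝ) + 1 / 2) ^ (-(2 * s.re))) *
          (2 * ‖f‖ * ((n : ℝ) + 1 / 2)⁻¹) :=
        mul_le_mul h1 h2 (norm_nonneg _) (by positivity)
    _ = 2 * Real.exp (π / 2 * |(2 * s).im|) * ‖f‖ *
          (((n : ℝ) + 1 / 2) ^ (-(2 * s.re)) * ((n : ℝ) + 1 / 2)⁻¹) := by ring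

/-- The continued sum converges absolutely on the half-plane `Re z ≥ -1/2` (`Re s > 0`). [folklore] -/
theorem mayerPairing_summable_mayerTerm_sub (f : MayerSpace) {z : ℂ} (hz : -(1 / 2 : ℝ) ≤ z.re)
    {s : ℂ} (hs : 0 < s.re) : Summable fun n => mayerTerm s (fun w => f.toFun w - f.toFun 0) n z :=
  Summable.of_norm_bounded (summable_mayerTerm_bound hs _)
    fun n => mayerPairing_norm_mayerTerm_sub_le f hz hs.le n

/-- Each term of the continued sum is holomorphic on the half-plane `Re z > -1/2`. [folklore] -/
theorem mayerPairing_differentiableOn_mayerTerm_sub (s : ℂ) (f : MayerSpace) (n : ℕ) :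
    DifferentiableOn ℂ (mayerTerm s (fun w => f.toFun w - f.toFun 0) n)
      {z : ℂ | -(1 / 2 : ℝ) < z.re} := by
  have hsub : {z : ℂ | -(1 / 2 : ℝ) < z.re} ⊆ {z : ℂ | -1 < z.re} := fun z hz => by
    have hz' : -(1 / 2 : ℝ) < z.re := hz
    show (-1 : ℝ) < z.re
    linarith
  have h1 := (differentiableOn_cpow_branch s n).mono hsub
  have h2 : DifferentiableOn ℂ (fun z => f.toFun (1 / (z + (n + 1)))) {z : ℂ | -(1 / 2 : ℝ) < z.re} :=
    f.differentiableOn_toFun.comp ((differentiableOn_one_div_branch n).mono hsub)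
      fun z hz => closedBall_one_one_subset_mayerDisc
        (mayerPairing_one_div_branch_mem (le_of_lt (by exact hz)) n)
  unfold mayerTerm
  exact h1.mul (h2.sub_const _)

/-- **The continued sum is holomorphic on the half-plane `Re z > -1/2`** (`Re s > 0`; M-test with
the uniform term estimate). [folklore] -/
theorem mayerPairing_differentiableOn_tsum_mayerTerm_sub {s : ℂ} (hs : 0 < s.re) (f : MayerSpace) :
    DifferentiableOn ℂ (fun z => ∑' n, mayerTerm s (fun w => f.toFun w - f.toFun 0) n z)
      {z : ℂ | -(1 / 2 : ℝ) < z.re} :=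
  Complex.differentiableOn_tsum_of_summable_norm (summable_mayerTerm_bound hs _)
    (mayerPairing_differentiableOn_mayerTerm_sub s f) (isOpen_lt continuous_const Complex.continuous_re)
    fun n _ hz => mayerPairing_norm_mayerTerm_sub_le f (le_of_lt hz) hs.le n

/-- **`mayerSum₀ s f` is holomorphic on the half-plane `Re z > -1/2`** for `f ∈ B(D)`, `0 < Re s`,
`s ≠ 1/2`. [folklore] -/
theorem mayerPairing_differentiableOn_mayerSum₀ {s : ℂ} (hs : 0 < s.re) (hs' : s ≠ 1 / 2)
    (f : MayerSpace) :
    DifferentiableOn ℂ (mayerSum₀ s f.toFun) {z : ℂ | -(1 / 2 : ℝ) < z.re} := by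
  have h2s : 2 * s ≠ 1 := fun h => hs' (by linear_combination h / 2)
  have h2σ : 0 < (2 * s).re := by simp; linarith
  have hH : DifferentiableOn ℂ (fun z => hurwitzZetaC (2 * s) (z + 1)) {z : ℂ | -(1 / 2 : ℝ) < z.re} :=
    (differentiableOn_hurwitzZetaC h2s h2σ).comp (differentiableOn_id.add_const _) fun z hz => by
      have hz' : -(1 / 2 : ℝ) < z.re := hz
      show (0 : ℝ) < (z + 1).re
      simp only [add_re, one_re]
      linarith
  exact ((differentiableOn_const _).mul hH).add (mayerPairing_differentiableOn_tsum_mayerTerm_sub hs f)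

/-- **Telescoping identity of the continued sum** on the half-plane `Re z ≥ -1/2`:
`(L_s f)(z) - (L_s f)(z+1) = (z+1)^{-2s} f(1/(z+1))` (pointwise for `mayerSum₀`; `0 < Re s`,
`s ≠ 1/2`). [cite: Mayer1991, eq. (1)] -/
theorem mayerPairing_mayerSum₀_sub_mayerSum₀_add_one {s : ℂ} (hs : 0 < s.re) (hs' : s ≠ 1 / 2)
    (f : MayerSpace) {z : ℂ} (hz : -(1 / 2 : ℝ) ≤ z.re) :
    mayerSum₀ s f.toFun z - mayerSum₀ s f.toFun (z + 1) =
      (z + 1) ^ (-(2 * s)) * f.toFun (1 / (z + 1)) := by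
  have h2s : 2 * s ≠ 1 := fun h => hs' (by linear_combination h / 2)
  have h2σ : 0 < (2 * s).re := by simp; linarith
  have hz1 : 0 < (z + 1).re := by simp only [add_re, one_re]; linarith
  -- Hurwitz part: `ζ(2s, z+1) - ζ(2s, z+2) = (z+1)^{-2s}`
  have hH := hurwitzZetaC_sub_add_one h2s h2σ hz1
  -- the series part: shifting `z` by one shifts the index by one
  set G : ℂ → ℂ := fun w => f.toFun w - f.toFun 0 with hG
  have hsum : Summable fun n => mayerTerm s G n z := mayerPairing_summable_mayerTerm_sub f hz hs
  have hshift : ∀ n : ℕ, mayerTerm s G n (z + 1) = mayerTerm s G (n + 1) z := by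
    intro n
    simp only [mayerTerm, Nat.cast_succ]
    ring_nf
  have e0 : ∑' n, mayerTerm s G n z = mayerTerm s G 0 z + ∑' n, mayerTerm s G n (z + 1) := by
    rw [hsum.tsum_eq_zero_add]
    congr 1
    exact tsum_congr fun n => (hshift n).symm
  have hT0 : mayerTerm s G 0 z = (z + 1) ^ (-(2 * s)) * (f.toFun (1 / (z + 1)) - f.toFun 0) := by
    simp [mayerTerm, hG]
  have eL : mayerSum₀ s f.toFun z = f.toFun 0 * hurwitzZetaC (2 * s) (z + 1) + ∑' n, mayerTerm s G n z :=
    rfl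
  have eR : mayerSum₀ s f.toFun (z + 1) =
      f.toFun 0 * hurwitzZetaC (2 * s) (z + 1 + 1) + ∑' n, mayerTerm s G n (z + 1) := rfl
  rw [eL, eR, e0, hT0]
  linear_combination f.toFun 0 * hH

/-- Integral comparison in the form used below: for `x ≥ 0`, `σ > 0`,
`∑ₙ (n + (x+1))^{-(2σ+1)} ≤ (x+1)^{-(2σ+1)} + (x+1)^{-2σ}/(2σ)`. [folklore] -/
theorem mayerPairing_tsum_shift_le {x σ : ℝ} (hx : 0 ≤ x) (hσ : 0 < σ) :
    ∑' n : ℕ, ((n : ℝ) + (x + 1)) ^ (-(2 * σ + 1)) ≤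
      (x + 1) ^ (-(2 * σ + 1)) + (x + 1) ^ (-(2 * σ)) / (2 * σ) := by
  have hx1 : 0 < x + 1 := by linarith
  have h := tsum_nat_add_rpow_neg_le_integral hx1 (by linarith : 1 < 2 * σ + 1)
  have e1 : (1 - (2 * σ + 1)) = -(2 * σ) := by ring
  have e2 : (2 * σ + 1 - 1) = 2 * σ := by ring
  rw [e1, e2] at h
  exact h

/-- Term estimate along the reals: for `x ≥ 0`, `f ∈ B(D)`, `Re s ≥ 0`,
`‖(x+n+1)^{-2s} (f(1/(x+n+1)) - f(0))‖ ≤ 2 e^{π|Im 2s|/2} ‖f‖ (n + (x+1))^{-(2 Re s+1)}` — the decay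
in `x` that the estimate on the disc does not see. [folklore] -/
theorem mayerPairing_norm_mayerTerm_sub_le_real (f : MayerSpace) {x : ℝ} (hx : 0 ≤ x) {s : ℂ}
    (hs : 0 ≤ s.re) (n : ℕ) :
    ‖mayerTerm s (fun w => f.toFun w - f.toFun 0) n x‖ ≤
      2 * Real.exp (π / 2 * |(2 * s).im|) * ‖f‖ * ((n : ℝ) + (x + 1)) ^ (-(2 * s.re + 1)) := by
  have hpos : (0 : ℝ) < (n : ℝ) + (x + 1) := by positivity
  have hre : ((x : ℂ) + (n + 1)).re = (n : ℝ) + (x + 1) := by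
    simp only [add_re, ofReal_re, natCast_re, one_re]; ring
  have hre0 : 0 < ((x : ℂ) + (n + 1)).re := by rw [hre]; exact hpos
  -- the power factor
  have hw : (-(2 * s)).re ≤ 0 := by simp; linarith
  have h1 : ‖((x : ℂ) + (n + 1)) ^ (-(2 * s))‖ ≤
      Real.exp (π / 2 * |(2 * s).im|) * ((n : ℝ) + (x + 1)) ^ (-(2 * s.re)) := by
    have h := norm_cpow_le_re_rpow_of_re_pos hre0 hw
    have hexp : (-(2 * s)).re = -(2 * s.re) := by simp
    have him : |(-(2 * s)).im| = |(2 * s).im| := by rw [neg_im, abs_neg]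
    rw [hexp, him, hre] at h
    exact h.trans_eq (mul_comm _ _)
  -- the Lipschitz factor
  have hball : 1 / ((x : ℂ) + (n + 1)) ∈ closedBall (1 : ℂ) 1 :=
    one_div_mem_closedBall_one_one (by rw [hre]; linarith [n.cast_nonneg (α := ℝ)])
  have h2 : ‖f.toFun (1 / ((x : ℂ) + (n + 1))) - f.toFun 0‖ ≤ 2 * ‖f‖ * ((n : ℝ) + (x + 1))⁻¹ := by
    refine (f.norm_toFun_sub_toFun_zero_le hball).trans ?_
    refine mul_le_mul_of_nonneg_left ?_ (by positivity)
    have h3 : (n : ℝ) + (x + 1) ≤ ‖(x : ℂ) + (n + 1)‖ := by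
      rw [← hre]; exact re_le_norm _
    rw [norm_div, norm_one, one_div]
    exact inv_anti₀ hpos h3
  have hsplit : ((n : ℝ) + (x + 1)) ^ (-(2 * s.re + 1)) =
      ((n : ℝ) + (x + 1)) ^ (-(2 * s.re)) * ((n : ℝ) + (x + 1))⁻¹ := by
    rw [show -(2 * s.re + 1) = -(2 * s.re) + (-1) by ring, Real.rpow_add hpos, Real.rpow_neg_one]
  unfold mayerTerm
  rw [norm_mul, hsplit]
  calc ‖((x : ℂ) + (n + 1)) ^ (-(2 * s))‖ * ‖f.toFun (1 / ((x : ℂ) + (n + 1))) - f.toFun 0‖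
      ≤ (Real.exp (π / 2 * |(2 * s).im|) * ((n : ℝ) + (x + 1)) ^ (-(2 * s.re))) *
          (2 * ‖f‖ * ((n : ℝ) + (x + 1))⁻¹) :=
        mul_le_mul h1 h2 (norm_nonneg _) (by positivity)
    _ = 2 * Real.exp (π / 2 * |(2 * s).im|) * ‖f‖ *
          (((n : ℝ) + (x + 1)) ^ (-(2 * s.re)) * ((n : ℝ) + (x + 1))⁻¹) := by ring

/-- **Normalisation of `L_s f` along the reals.** For `f ∈ B(D)`, `0 < Re s`, `s ≠ 1/2`:
`(L_s f)(x) - f(0) (x+1)^{1-2s}/(2s-1) → 0` as the real variable `x → +∞` (the Hurwitz part is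
`f(0)(ζ(2s,x+1) - (x+1)^{1-2s}/(2s-1)) = O((x+1)^{-2 Re s})`, the branch sum is `O((x+1)^{-2 Re s})`).
This is the asymptotic clause of the route's eigenvalue predicate for `λ f = L_s f`.
[cite: ChangMayer2001, (3.21)–(3.23) and (4.15)] -/
theorem mayerPairing_tendsto_mayerSum₀_normalisation {s : ℂ} (hs : 0 < s.re) (hs' : s ≠ 1 / 2)
    (f : MayerSpace) :
    Tendsto (fun x : ℝ => mayerSum₀ s f.toFun x -
      f.toFun 0 * ((x : ℂ) + 1) ^ (1 - 2 * s) / (2 * s - 1)) atTop (𝓝 0) := by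
  have h2s : 2 * s ≠ 1 := fun h => hs' (by linear_combination h / 2)
  have h2σ : 0 < (2 * s).re := by simp; linarith
  set σ : ℝ := s.re with hσdef
  set e : ℝ := Real.exp (π / 2 * |(2 * s).im|) with he
  set g : ℝ → ℝ := fun x => (x + 1) ^ (-(2 * σ + 1)) + (x + 1) ^ (-(2 * σ)) / (2 * σ) with hg
  -- `g → 0`
  have hg0 : Tendsto g atTop (𝓝 0) := by
    have h1 : Tendsto (fun x : ℝ => (x + 1) ^ (-(2 * σ + 1))) atTop (𝓝 0) :=
      (tendsto_rpow_neg_atTop (by positivity)).comp (tendsto_atTop_add_const_right _ _ tendsto_id)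
    have h2 : Tendsto (fun x : ℝ => (x + 1) ^ (-(2 * σ))) atTop (𝓝 0) :=
      (tendsto_rpow_neg_atTop (by positivity)).comp (tendsto_atTop_add_const_right _ _ tendsto_id)
    simpa [hg] using h1.add (h2.div_const (2 * σ))
  set K : ℝ := ‖f.toFun 0‖ * (‖2 * s‖ * e) + 2 * e * ‖f‖ with hK
  -- the bound for `x ≥ 0`
  have hbound : ∀ x : ℝ, 0 ≤ x →
      ‖mayerSum₀ s f.toFun x - f.toFun 0 * ((x : ℂ) + 1) ^ (1 - 2 * s) / (2 * s - 1)‖ ≤ K * g x := by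
    intro x hx
    have hx1 : 0 < x + 1 := by linarith
    have hcmp : ∑' n : ℕ, ((n : ℝ) + (x + 1)) ^ (-(2 * σ + 1)) ≤ g x := mayerPairing_tsum_shift_le hx hs
    have hgx : 0 ≤ g x := (tsum_nonneg fun n => Real.rpow_nonneg (by positivity) _).trans hcmp
    -- Hurwitz part
    have hT1 : ‖hurwitzZetaC (2 * s) ((x : ℂ) + 1) - ((x : ℂ) + 1) ^ (1 - 2 * s) / (2 * s - 1)‖ ≤
        ‖2 * s‖ * e * g x := by
      have h := norm_hurwitzZetaC_sub_le (s := 2 * s) (a := (x : ℂ) + 1) (δ := x + 1) h2s h2σ hx1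
        (by simp)
      have hre : (2 * s).re = 2 * σ := by simp [hσdef]
      rw [hre] at h
      exact h.trans (mul_le_mul_of_nonneg_left hcmp (by positivity))
    -- branch sum
    have hT2 : ‖∑' n : ℕ, mayerTerm s (fun w => f.toFun w - f.toFun 0) n x‖ ≤ 2 * e * ‖f‖ * g x := by
      have hsum := (summable_nat_add_rpow_neg hx1 (by positivity : 0 < 2 * σ)).mul_left (2 * e * ‖f‖)
      have h := tsum_of_norm_bounded hsum.hasSum
        fun n => mayerPairing_norm_mayerTerm_sub_le_real f hx hs.le n
      rw [tsum_mul_left] at h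
      exact h.trans (mul_le_mul_of_nonneg_left hcmp (by positivity))
    have hdec : mayerSum₀ s f.toFun x - f.toFun 0 * ((x : ℂ) + 1) ^ (1 - 2 * s) / (2 * s - 1) =
        f.toFun 0 * (hurwitzZetaC (2 * s) ((x : ℂ) + 1) - ((x : ℂ) + 1) ^ (1 - 2 * s) / (2 * s - 1)) +
          ∑' n : ℕ, mayerTerm s (fun w => f.toFun w - f.toFun 0) n x := by
      rw [mayerSum₀]
      ring
    rw [hdec]
    calc ‖f.toFun 0 * (hurwitzZetaC (2 * s) ((x : ℂ) + 1) - ((x : ℂ) + 1) ^ (1 - 2 * s) / (2 * s - 1)) +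
          ∑' n : ℕ, mayerTerm s (fun w => f.toFun w - f.toFun 0) n x‖
        ≤ ‖f.toFun 0 * (hurwitzZetaC (2 * s) ((x : ℂ) + 1) - ((x : ℂ) + 1) ^ (1 - 2 * s) / (2 * s - 1))‖ +
          ‖∑' n : ℕ, mayerTerm s (fun w => f.toFun w - f.toFun 0) n x‖ := norm_add_le _ _
      _ ≤ ‖f.toFun 0‖ * (‖2 * s‖ * e * g x) + 2 * e * ‖f‖ * g x := by
          rw [norm_mul]
          exact add_le_add (mul_le_mul_of_nonneg_left hT1 (norm_nonneg _)) hT2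
      _ = K * g x := by rw [hK]; ring
  have hlim : Tendsto (fun x => K * g x) atTop (𝓝 0) := by simpa using hg0.const_mul K
  refine squeeze_zero_norm' ?_ hlim
  filter_upwards [eventually_ge_atTop (0 : ℝ)] with x hx using hbound x hx

/-! ### Part 2. Identity-theorem lemmas -/

/-- **Identity theorem along a real interval.** A function holomorphic on an open preconnected
set `U ⊆ ℂ` that vanishes at the real points of an interval `(a, b) ⊂ U` vanishes on `U`.
[folklore] -/
theorem mayerPairing_eqOn_zero_of_real_zeros {U : Set ℂ} (hU : IsOpen U) (hU' : IsPreconnected U)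
    {F : ℂ → ℂ} (hF : DifferentiableOn ℂ F U) {a b : ℝ} (hab : a < b)
    (hmem : ∀ x : ℝ, a < x → x < b → (x : ℂ) ∈ U) (hzero : ∀ x : ℝ, a < x → x < b → F x = 0) :
    ∀ z ∈ U, F z = 0 := by
  have hA : AnalyticOnNhd ℂ F U := hF.analyticOnNhd hU
  set x₀ : ℝ := (a + b) / 2 with hx₀
  have hx₀a : a < x₀ := by rw [hx₀]; linarith
  have hx₀b : x₀ < b := by rw [hx₀]; linarith
  have hz₀ : ((x₀ : ℝ) : ℂ) ∈ U := hmem x₀ hx₀a hx₀b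
  have hfreq : ∃ᶠ z in 𝓝[≠] ((x₀ : ℝ) : ℂ), F z = 0 := by
    intro hev
    obtain ⟨ε, hε, hsub⟩ := Metric.mem_nhdsWithin_iff.1 hev
    set t : ℝ := min (ε / 2) ((b - x₀) / 2) with ht
    have ht0 : 0 < t := lt_min (by linarith) (by linarith)
    have htε : t < ε := (min_le_left _ _).trans_lt (by linarith)
    have htb : x₀ + t < b := by
      have := min_le_right (ε / 2) ((b - x₀) / 2)
      linarith
    have hmemball : ((x₀ + t : ℝ) : ℂ) ∈ ball ((x₀ : ℝ) : ℂ) ε ∩ {((x₀ : ℝ) : ℂ)}ᶜ := by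
      constructor
      · rw [mem_ball, dist_eq_norm, ← ofReal_sub, norm_real, Real.norm_eq_abs,
          show x₀ + t - x₀ = t by ring, abs_of_pos ht0]
        exact htε
      · intro h
        have h1 : ((x₀ + t : ℝ) : ℂ) = ((x₀ : ℝ) : ℂ) := Set.mem_singleton_iff.1 h
        have h' : x₀ + t = x₀ := by exact_mod_cast h1
        linarith
    exact hsub hmemball (hzero (x₀ + t) (by linarith) htb)
  exact hA.eqOn_zero_of_preconnected_of_frequently_eq_zero hU' hz₀ hfreq

/-- **A `1`-periodic holomorphic function on the half-plane `Re z > -1/2` tending to `0` along the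
reals vanishes identically** (it vanishes at every real point by periodicity, then everywhere by
the identity theorem). This is what pins the periodic function `c = μ f - L_s f` of a solution of
the three-term equation to `0` under the normalisation clause. [folklore] -/
theorem mayerPairing_eq_zero_of_periodic_of_tendsto {C : ℂ → ℂ}
    (hC : DifferentiableOn ℂ C {z : ℂ | -(1 / 2 : ℝ) < z.re})
    (hper : ∀ z : ℂ, -(1 / 2 : ℝ) < z.re → C (z + 1) = C z)
    (hlim : Tendsto (fun x : ℝ => C x) atTop (𝓝 0)) :
    ∀ z : ℂ, -(1 / 2 : ℝ) < z.re → C z = 0 := by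
  -- real points
  have hreal : ∀ x : ℝ, -(1 / 2 : ℝ) < x → C x = 0 := by
    intro x hx
    have hn : ∀ n : ℕ, C (((x + n : ℝ)) : ℂ) = C x := by
      intro n
      induction n with
      | zero => simp
      | succ n ih =>
        have hre : -(1 / 2 : ℝ) < (((x + n : ℝ)) : ℂ).re := by
          simp only [ofReal_re]; linarith [n.cast_nonneg (α := ℝ)]
        have := hper _ hre
        push_cast at this ih ⊢
        rw [show (x : ℂ) + ((n : ℂ) + 1) = (x : ℂ) + (n : ℂ) + 1 by ring, this, ih]
    have h1 : Tendsto (fun n : ℕ => C (((x + n : ℝ)) : ℂ)) atTop (𝓝 0) :=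
      hlim.comp (tendsto_atTop_add_const_left _ _ tendsto_natCast_atTop_atTop)
    simp_rw [hn] at h1
    exact tendsto_nhds_unique tendsto_const_nhds h1
  -- identity theorem on the (convex) half-plane
  refine mayerPairing_eqOn_zero_of_real_zeros (isOpen_lt continuous_const Complex.continuous_re)
    (convex_halfSpace_re_gt _).isPreconnected hC zero_lt_one (fun x hx _ => ?_)
    (fun x hx _ => hreal x (by linarith))
  show -(1 / 2 : ℝ) < (x : ℂ).re
  simp only [ofReal_re]
  linarith

/-! ### Part 3. Small geometric lemmas -/

/-- The point `1/(z+1)` lies in the closed disc for `Re z ≥ -1/2`. [folklore] -/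
theorem mayerPairing_one_div_add_one_mem {z : ℂ} (hz : -(1 / 2 : ℝ) ≤ z.re) :
    1 / (z + 1) ∈ mayerClosedDisc := by
  have h := mayerPairing_one_div_branch_mem hz 0
  simp only [Nat.cast_zero, zero_add] at h
  exact mayerDisc_subset_mayerClosedDisc (closedBall_one_one_subset_mayerDisc h)

/-- Real points of `(0, 2)` lie in Mayer's open disc. [folklore] -/
theorem mayerPairing_ofReal_mem_mayerDisc {x : ℝ} (h0 : -(1 / 2 : ℝ) < x) (h2 : x < 5 / 2) :
    (x : ℂ) ∈ mayerDisc := by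
  rw [mem_mayerDisc, dist_eq_norm, ← ofReal_one, ← ofReal_sub, norm_real, Real.norm_eq_abs, abs_lt]
  constructor <;> linarith

/-- Inversion maps the open right half-plane into itself. [folklore] -/
theorem mayerPairing_one_div_re_pos {w : ℂ} (hw : 0 < w.re) : 0 < (1 / w).re := by
  have hw0 : w ≠ 0 := fun h => by rw [h, zero_re] at hw; exact lt_irrefl _ hw
  rw [one_div, inv_re]
  exact div_pos hw (normSq_pos.2 hw0)

/-- Points of Mayer's open disc have real part `> -1/2`. [folklore] -/
theorem mayerPairing_re_gt_of_mem_mayerDisc {z : ℂ} (hz : z ∈ mayerDisc) : -(1 / 2 : ℝ) < z.re := by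
  rw [mem_mayerDisc, dist_eq_norm] at hz
  have h := (abs_re_le_norm (z - 1)).trans_lt hz
  rw [sub_re, one_re, abs_lt] at h
  linarith [h.1]

end Summit.RiemannHypothesis.RiemannHypothesis.Theorems
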